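import Mathlib
import Summits.NavierStokesRegularity.NavierStokesRegularity.Theses.CoriolisHead
import HarnessLib

/-!
# `CoriolisHead.Assembly` — the route's assembly (item stmt-NavierStokesRegularity-22680; pure logic)

**Statement.** `NoCoRotatingCore → CounterRotatingLiouville → SolitonToProfile →
ExtremalSpiralSymmetry → MinimiserExists → NoTypeII → NavierStokesRegularity`.

PROOF. The route file `Theses/CoriolisHead.lean` carries the planner-authored, kernel-checked
deciding theorem `Theses.CoriolisHead.closes`, whose hypotheses are exactly the route's items and
whose conclusion is the sub-problem Statement; the assembly item is that implication written as ONE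
proposition, so it is closed by applying `closes` to the hypotheses. This proves an IMPLICATION
only: the hypotheses (four of them open cruxes) remain hypotheses.

HONEST FRAMING: pure logic between the route's own statements; the file does NOT prove
`NavierStokesRegularity` — it proves that the route's items would imply it.
-/

noncomputable section

set_option linter.dupNamespace false

namespace Summit.NavierStokesRegularity.NavierStokesRegularity.Theorems

open Summit.NavierStokesRegularity.NavierStokesRegularity.Theses.CoriolisHead in
/-- **Item stmt-NavierStokesRegularity-22680** (`CoriolisHead.Assembly`): the route's items imply
the sub-problem Statement, by the route file's deciding theorem `closes` (an implication; its
hypotheses stay hypotheses). [this file] -/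
theorem coriolisHead_assembly_proof :
    Summit.NavierStokesRegularity.NavierStokesRegularity.Theses.CoriolisHead.Assembly := by
  unfold Summit.NavierStokesRegularity.NavierStokesRegularity.Theses.CoriolisHead.Assembly
  intro h₁ h₂ h₃ h₄ h₅ h₆
  exact closes h₁ h₂ h₃ h₄ h₅ h₆

end Summit.NavierStokesRegularity.NavierStokesRegularity.Theorems

end
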